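import Summits.ResolutionOfSingularities.ResolutionOfSingularities.Theorems.PurelyInseparableDim4PiPlateauStatement
import Summits.ResolutionOfSingularities.ResolutionOfSingularities.Theorems.PurelyInseparableDim4HasseEuler
import Literature.AlgebraicGeometry.Resolution.PointBlowupMohWitnessPrimePower
import Literature.AlgebraicGeometry.Resolution.PointBlowupMohBound
import HarnessLib

/-!
# Π, brick T1: the CLASS DECOMPOSITION of a point-blow-up transform (cell `res-dim4-pi`, I-5-5)

[OURS · counted 0 · instrument lemma]  Nothing here is a statement about resolution of singularities in
dimension ≥ 4 / characteristic `p`, which is NOT proved.  Section §1 «Classes» of res-dim4-idea-5's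
consolidated write-up `PiPlateau-consolidated.md` (ecef900b4de1a97c), over the tree's point blow-up
`CentreBlowup.pointTransform q univ j t s = translate t (chartTransform q univ j s.F)` with `t j = 0`:

* `tPart t b` — the restriction of an exponent to the TRANSLATED variables `T = {m : t m ≠ 0}`;
  `cls q j t b` — the CLASS exponent `x_j^{|b| − q} · x_U^{b_U}` (`U` = untranslated variables `≠ j`);
  `chartExponent_eq_cls_add_tPart`;
* `translate_monomial_chartExponent` — the factorisation
  `(x^b)* (x + t) = x^{cls b} · (x_T + t_T)^{b_T}`, and `pointTransform_eq_sum_cls`;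
* `classPoly q j t F γ = G_γ := Σ_{cls b = γ} c_b (x_T + t_T)^{b_T}` and **(C1)** `coeff_pointTransform`:
  `coeff_e (F*) = coeff_{e_T} (G_{e|_{t = 0}})` — monomials from different classes never mix;
* **(C2)** `eq_of_cls_eq_of_tPart_eq` — within a class `b ↦ b_T` is injective (for `q ≤ |b|`);
* **(C3)** `classPoly_ne_zero` — an occurring class has `G_γ ≠ 0`;
* **(C4)** is the tree's `coeff_deletePthPowers` (cleaning acts monomial by monomial) — cited, not restated.

Typed by res-dim4-typ-1.  Supports stmt-ResolutionOfSingularities-16155 (helper).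
bears_on: LADDER-RESOLUTION:D157-DOOR2 (res-dim4-pi · I-5-5 Π · T1 classes).
-/

set_option linter.dupNamespace false -- mandated namespace of this single-conjunct summit

namespace Summit.ResolutionOfSingularities.ResolutionOfSingularities.Theorems.PIDim4

namespace Plateau

open MvPolynomial Finset
open Literature.AlgebraicGeometry.Resolution
open Literature.AlgebraicGeometry.Resolution.Hauser2010
open Literature.AlgebraicGeometry.Resolution.CentreBlowup

variable {σ : Type*} {K : Type*} [Field K] [DecidableEq K]

/-! ## §1 The class exponent and the translated part -/

/-- The part of the exponent `b` in the TRANSLATED variables `T = {m : t m ≠ 0}`. [folklore] -/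
def tPart (t : σ → K) (b : σ →₀ ℕ) : σ →₀ ℕ := b.filter fun m => t m ≠ 0

/-- The part of `b` in the UNtranslated variables `{m : t m = 0}` (this includes the chart variable). [folklore] -/
def uPart (t : σ → K) (b : σ →₀ ℕ) : σ →₀ ℕ := b.filter fun m => t m = 0

/-- Values of `tPart`. [folklore] -/
theorem tPart_apply (t : σ → K) (b : σ →₀ ℕ) (m : σ) : tPart t b m = if t m ≠ 0 then b m else 0 := by
  unfold tPart; rw [Finsupp.filter_apply]

/-- Values of `uPart`. [folklore] -/
theorem uPart_apply (t : σ → K) (b : σ →₀ ℕ) (m : σ) : uPart t b m = if t m = 0 then b m else 0 := by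
  unfold uPart; rw [Finsupp.filter_apply]

/-- `b = uPart + tPart`. [folklore] -/
theorem uPart_add_tPart (t : σ → K) (b : σ →₀ ℕ) : uPart t b + tPart t b = b := by
  ext m
  rw [Finsupp.coe_add, Pi.add_apply, uPart_apply, tPart_apply]
  by_cases h : t m = 0 <;> simp [h]

/-- `tPart` is additive. [folklore] -/
theorem tPart_add (t : σ → K) (b b' : σ →₀ ℕ) : tPart t (b + b') = tPart t b + tPart t b' := by
  ext m; simp only [tPart_apply, Finsupp.coe_add, Pi.add_apply]; split_ifs <;> simp

/-- `uPart` is additive. [folklore] -/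
theorem uPart_add (t : σ → K) (b b' : σ →₀ ℕ) : uPart t (b + b') = uPart t b + uPart t b' := by
  ext m; simp only [uPart_apply, Finsupp.coe_add, Pi.add_apply]; split_ifs <;> simp

/-- `tPart` of an exponent supported in the untranslated variables is `0`. [folklore] -/
theorem tPart_eq_zero_of (t : σ → K) {b : σ →₀ ℕ} (h : ∀ m ∈ b.support, t m = 0) : tPart t b = 0 := by
  ext m; rw [tPart_apply, Finsupp.coe_zero, Pi.zero_apply]
  split_ifs with hm
  · exact Finsupp.notMem_support_iff.mp fun hb => hm (h m hb)
  · rfl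

/-- `uPart` of an exponent supported in the translated variables is `0`. [folklore] -/
theorem uPart_eq_zero_of (t : σ → K) {b : σ →₀ ℕ} (h : ∀ m ∈ b.support, t m ≠ 0) : uPart t b = 0 := by
  ext m; rw [uPart_apply, Finsupp.coe_zero, Pi.zero_apply]
  split_ifs with hm
  · exact Finsupp.notMem_support_iff.mp fun hb => h m hb hm
  · rfl

/-- `uPart (tPart b) = 0`. [folklore] -/
theorem uPart_tPart (t : σ → K) (b : σ →₀ ℕ) : uPart t (tPart t b) = 0 := by
  ext m; rw [uPart_apply, tPart_apply, Finsupp.coe_zero, Pi.zero_apply]; by_cases h : t m = 0 <;> simp [h]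

/-- `tPart (tPart b) = tPart b`. [folklore] -/
theorem tPart_tPart (t : σ → K) (b : σ →₀ ℕ) : tPart t (tPart t b) = tPart t b := by
  ext m; rw [tPart_apply, tPart_apply]; by_cases h : t m = 0 <;> simp [h]

variable [DecidableEq σ]

/-- **The class exponent** `cls b = x_j^{|b| − q} · x_U^{b_U}`: the untranslated part of `b` with the chart
entry replaced by `|b| − q` (write-up §1: `σ(b) = (|b|, b_U)` read as one monomial). [folklore] -/
noncomputable def cls (q : ℕ) (j : σ) (t : σ → K) (b : σ →₀ ℕ) : σ →₀ ℕ := (uPart t b).update j (b.degree - q)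

/-- Values of `cls`. [folklore] -/
theorem cls_apply (q : ℕ) (j : σ) (t : σ → K) (b : σ →₀ ℕ) (m : σ) :
    cls q j t b m = if m = j then b.degree - q else if t m = 0 then b m else 0 := by
  unfold cls; rw [Finsupp.update_apply, uPart_apply]

/-- `cls b` lives in the untranslated variables (`t j = 0`). [folklore] -/
theorem apply_eq_zero_of_mem_support_cls (q : ℕ) {j : σ} {t : σ → K} (ht : t j = 0) (b : σ →₀ ℕ)
    {m : σ} (hm : m ∈ (cls q j t b).support) : t m = 0 := by
  rw [Finsupp.mem_support_iff, cls_apply] at hm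
  by_cases hmj : m = j
  · rw [hmj]; exact ht
  · rw [if_neg hmj] at hm
    by_contra h
    exact hm (if_neg h)

variable [Fintype σ]

/-- **The chart law splits**: `chartExponent q univ j b = cls b + tPart b` (`t j = 0`). [folklore] -/
theorem chartExponent_eq_cls_add_tPart (q : ℕ) {j : σ} {t : σ → K} (ht : t j = 0) (b : σ →₀ ℕ) :
    chartExponent q Finset.univ j b = cls q j t b + tPart t b := by
  ext m
  rw [chartExponent_apply, degIn_univ, Finsupp.coe_add, Pi.add_apply, cls_apply, tPart_apply]
  by_cases hmj : m = j
  · subst hmj; simp [ht]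
  · rw [if_neg hmj, if_neg hmj]
    by_cases h : t m = 0 <;> simp [h]

/-! ## §2 The factorisation `(x^b)*(x + t) = x^{cls b} · (x_T + t_T)^{b_T}` -/

omit [DecidableEq K] in
/-- Translation does not move a monomial in UNtranslated variables. [folklore] -/
theorem translate_monomial_of_forall_eq_zero (t : σ → K) (γ : σ →₀ ℕ) (a : K)
    (h : ∀ m ∈ γ.support, t m = 0) : PointBlowup.translate t (monomial γ a) = monomial γ a := by
  rw [PointBlowup.translate_monomial_eq_prod, MvPolynomial.monomial_eq, Finsupp.prod_pow]
  congr 1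
  refine Finset.prod_congr rfl fun m _ => ?_
  by_cases hm : m ∈ γ.support
  · rw [h m hm, map_zero, add_zero]
  · rw [Finsupp.notMem_support_iff.mp hm, pow_zero, pow_zero]

/-- **Factorisation of a transformed monomial**: `translate t ((x^b)^*) = x^{cls b} · translate t (x^{b_T})`.
[folklore] -/
theorem translate_monomial_chartExponent (q : ℕ) {j : σ} {t : σ → K} (ht : t j = 0) (b : σ →₀ ℕ)
    (c : K) :
    PointBlowup.translate t (monomial (chartExponent q Finset.univ j b) c) =
      monomial (cls q j t b) (1 : K) * PointBlowup.translate t (monomial (tPart t b) c) := by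
  rw [chartExponent_eq_cls_add_tPart q ht, ← one_mul c, ← monomial_mul, one_mul, MohAlong.translate_mul,
    translate_monomial_of_forall_eq_zero t _ _ (fun m hm => apply_eq_zero_of_mem_support_cls q ht b hm)]

/-- **The point transform as a sum of factorised terms** (`t j = 0`):
`F* = Σ_b c_b · x^{cls b} · (x_T + t_T)^{b_T}`. [folklore] -/
theorem pointTransform_eq_sum_cls (q : ℕ) {j : σ} {t : σ → K} (ht : t j = 0) (s : CState σ K) :
    pointTransform q Finset.univ j t s =
      ∑ b ∈ s.F.support, monomial (cls q j t b) (1 : K) *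
        PointBlowup.translate t (monomial (tPart t b) (coeff b s.F)) := by
  unfold pointTransform chartTransform
  rw [HasseEuler.translate_sum']
  exact Finset.sum_congr rfl fun b _ => translate_monomial_chartExponent q ht b _

/-! ## §3 The class polynomials `G_γ` and (C1) -/

/-- **The class polynomial** `G_γ = Σ_{b ∈ supp F, cls b = γ} c_b (x_T + t_T)^{b_T} ∈ K[x_T]`. [folklore] -/
noncomputable def classPoly (q : ℕ) (j : σ) (t : σ → K) (F : MvPolynomial σ K) (γ : σ →₀ ℕ) :
    MvPolynomial σ K :=
  ∑ b ∈ F.support with cls q j t b = γ, PointBlowup.translate t (monomial (tPart t b) (coeff b F))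

/-- A monomial of `translate t (x^τ)`, `τ` supported in `T`, is supported in `T`: its untranslated part is
`0`. [folklore] -/
theorem uPart_eq_zero_of_coeff_translate_tPart (t : σ → K) (b : σ →₀ ℕ) (c : K) {δ : σ →₀ ℕ}
    (hδ : coeff δ (PointBlowup.translate t (monomial (tPart t b) c)) ≠ 0) : uPart t δ = 0 := by
  have hle := PointBlowup.le_of_coeff_translate_monomial_ne_zero t hδ
  refine uPart_eq_zero_of t fun m hm htm => ?_
  have h1 : δ m ≤ tPart t b m := hle m
  rw [tPart_apply, if_neg (not_not.mpr htm)] at h1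
  exact (Finsupp.mem_support_iff.mp hm) (Nat.le_zero.mp h1)

/-- One factorised term contributes to `x^e` only through its own class: `coeff_e (x^γ · G) =
coeff_{e_T} G` if `γ = e|_{t=0}`, and `0` otherwise, for `G` a translate of a `T`-monomial. [folklore] -/
theorem coeff_monomial_cls_mul (t : σ → K) {γ : σ →₀ ℕ} (hγ : ∀ m ∈ γ.support, t m = 0)
    (b : σ →₀ ℕ) (c : K) (e : σ →₀ ℕ) :
    coeff e (monomial γ (1 : K) * PointBlowup.translate t (monomial (tPart t b) c)) =
      if γ = uPart t e then coeff (tPart t e) (PointBlowup.translate t (monomial (tPart t b) c)) else 0 := by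
  rw [coeff_monomial_mul']
  by_cases hγe : γ = uPart t e
  · have hle : γ ≤ e := by
      rw [hγe]
      exact Finsupp.le_def.mpr fun m => by rw [uPart_apply]; split_ifs <;> omega
    rw [if_pos hle, if_pos hγe, one_mul]
    congr 1
    rw [hγe]
    ext m
    rw [Finsupp.tsub_apply, uPart_apply, tPart_apply]
    by_cases h : t m = 0 <;> simp [h]
  · rw [if_neg hγe]
    split_ifs with hle
    · rw [one_mul]
      by_contra hne
      apply hγe
      have hu := uPart_eq_zero_of_coeff_translate_tPart t b c hne
      -- `uPart (e - γ) = 0` and `γ ≤ e`, `γ` untranslated ⇒ `γ = uPart e`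
      ext m
      have h1 : uPart t (e - γ) m = 0 := by rw [hu]; rfl
      rw [uPart_apply, Finsupp.tsub_apply] at h1
      rw [uPart_apply]
      by_cases htm : t m = 0
      · rw [if_pos htm] at h1 ⊢
        have := hle m
        omega
      · rw [if_neg htm]
        exact Finsupp.notMem_support_iff.mp fun hm => htm (hγ m hm)
    · rfl

/-- **(C1) Classes do not mix**: the coefficient of `x^e` in the point transform `F*` is the coefficient of
`x^{e_T}` in the class polynomial of the class `e|_{t = 0}`. [folklore] -/
theorem coeff_pointTransform (q : ℕ) {j : σ} {t : σ → K} (ht : t j = 0) (s : CState σ K) (e : σ →₀ ℕ) :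
    coeff e (pointTransform q Finset.univ j t s) =
      coeff (tPart t e) (classPoly q j t s.F (uPart t e)) := by
  rw [pointTransform_eq_sum_cls q ht, coeff_sum, classPoly, coeff_sum, Finset.sum_filter]
  refine Finset.sum_congr rfl fun b _ => ?_
  rw [coeff_monomial_cls_mul t (fun m hm => apply_eq_zero_of_mem_support_cls q ht b hm)]

/-! ## §4 (C2) injectivity inside a class and (C3) non-vanishing of the class polynomials -/

/-- **(C2)**: inside a class, `b ↦ b_T` is injective (for exponents of degree `≥ q`, where `|b| − q` is
an honest difference). [folklore] -/
theorem eq_of_cls_eq_of_tPart_eq (q : ℕ) {j : σ} {t : σ → K} (ht : t j = 0) {b b' : σ →₀ ℕ}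
    (hq : q ≤ b.degree) (hq' : q ≤ b'.degree) (hcls : cls q j t b = cls q j t b')
    (hT : tPart t b = tPart t b') : b = b' := by
  -- off the chart variable the two exponents agree
  have hoff : ∀ m, m ≠ j → b m = b' m := by
    intro m hmj
    by_cases htm : t m = 0
    · have := DFunLike.congr_fun hcls m
      rw [cls_apply, cls_apply, if_neg hmj, if_neg hmj, if_pos htm, if_pos htm] at this
      exact this
    · have := DFunLike.congr_fun hT m
      rw [tPart_apply, tPart_apply, if_pos htm, if_pos htm] at this
      exact this
  -- and the degrees agree, hence so do the chart entries
  have hdeg : b.degree = b'.degree := by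
    have := DFunLike.congr_fun hcls j
    rw [cls_apply, cls_apply, if_pos rfl, if_pos rfl] at this
    omega
  classical
  have hsplit : ∀ d : σ →₀ ℕ, d.degree = d j + ∑ m ∈ Finset.univ.erase j, d m := by
    intro d
    rw [← degIn_univ, degIn, ← Finset.add_sum_erase _ _ (Finset.mem_univ j)]
  ext m
  by_cases hmj : m = j
  · subst hmj
    have h1 := hsplit b
    have h2 := hsplit b'
    have h3 : ∑ m ∈ Finset.univ.erase m, b m = ∑ m ∈ Finset.univ.erase m, b' m :=
      Finset.sum_congr rfl fun x hx => hoff x (Finset.ne_of_mem_erase hx)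
    omega
  · exact hoff m hmj

/-- **(C3)**: the class polynomial of an occurring class is non-zero (translated monomials with distinct
exponents are linearly independent — translation is injective). [folklore] -/
theorem classPoly_ne_zero (q : ℕ) {j : σ} {t : σ → K} (ht : t j = 0) (F : MvPolynomial σ K)
    (hF : ∀ b ∈ F.support, q ≤ b.degree) {b₀ : σ →₀ ℕ} (hb₀ : b₀ ∈ F.support) :
    classPoly q j t F (cls q j t b₀) ≠ 0 := by
  unfold classPoly
  rw [← HasseEuler.translate_sum']
  apply PointBlowup.translate_ne_zero
  -- the coefficient of `x^{tPart b₀}` in the inner sum is `coeff b₀ F ≠ 0`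
  intro h0
  have hc := congrArg (coeff (tPart t b₀)) h0
  have hmem : b₀ ∈ F.support.filter (fun b => cls q j t b = cls q j t b₀) :=
    Finset.mem_filter.mpr ⟨hb₀, rfl⟩
  rw [coeff_sum, coeff_zero, Finset.sum_eq_single_of_mem b₀ hmem] at hc
  · rw [coeff_monomial, if_pos rfl] at hc
    exact (MvPolynomial.mem_support_iff.mp hb₀) hc
  · intro b hb hne
    rw [Finset.mem_filter] at hb
    rw [coeff_monomial, if_neg]
    intro hT
    exact hne (eq_of_cls_eq_of_tPart_eq q ht (hF b hb.1) (hF b₀ hb₀) hb.2 hT)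

/-- **(C4)** is coefficientwise cleaning, the tree's `coeff_deletePthPowers`; recorded here in the class
language: the child `F′ = (step …).F` has `coeff_e F′ = 0` if `e` is a `q`-th power exponent and
`= coeff_{e_T} G_{e|_{t=0}}` otherwise. [folklore] -/
theorem coeff_step_F (q : ℕ) {j : σ} {t : σ → K} (ht : t j = 0) (s : CState σ K) (e : σ →₀ ℕ) :
    coeff e (CentreBlowup.step q Finset.univ j t s).F =
      if IsPthPowerExponent q e then 0 else coeff (tPart t e) (classPoly q j t s.F (uPart t e)) := by
  show coeff e (deletePthPowers q (pointTransform q Finset.univ j t s)) = _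
  rw [coeff_deletePthPowers, coeff_pointTransform q ht]

end Plateau

end Summit.ResolutionOfSingularities.ResolutionOfSingularities.Theorems.PIDim4
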